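import Summits.HodgeConjecture.HodgeConjecture.Theses.PadicSemiregularLift
import Summits.HodgeConjecture.HodgeConjecture.Theorems.PadicSemiregularLiftHodgeAbelianVarietiesStubVhcFromCMFibre
import Summits.HodgeConjecture.HodgeConjecture.Theorems.PadicSemiregularLiftHodgeAbelianVarietiesStubCmAnchoredFamilies
import Summits.HodgeConjecture.HodgeConjecture.Theorems.PadicSemiregularLiftHodgeAbelianVarietiesUnconditionalCorners
import Summits.HodgeConjecture.HodgeConjecture.Theorems.PadicSemiregularLiftHodgeAbelianVarietiesCMPivotStubLocalVHCAtCM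
import Summits.HodgeConjecture.HodgeConjecture.Theorems.HodgeAbelianVarieties.Negative.ExtremeCodimensions
import Literature.AlgebraicGeometry.HodgeTheory.InvariantClassesFromTotalSpaceHolds
import Literature.AlgebraicGeometry.HodgeTheory.AlgebraicityLocusIUnionClosedProofs
import Literature.AlgebraicGeometry.HodgeTheory.HardLefschetzNFoldHolds
import Literature.AlgebraicGeometry.HodgeTheory.LefschetzOneOneHolds
import Literature.AlgebraicGeometry.HodgeTheory.TopDegreeClasses

/-!
# Crux `HodgeAbelianVarieties` (stmt-HodgeConjecture-1333), line `cm-pivot` — gen 3: the transport half WITHOUT the abelian-fibres hypothesis (Hodge-ness along ALL fibres), and the three-statement composition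

Route `PadicSemiregularLift`, crux r4 `HodgeAbelianVarieties := ∀ A : AbelianVariety ℂ, HodgeConjectureFor A.dim A.X`.

Gen 2 of the line (this lead) reduced the crux to `stmt-3052 (HC for CM abelian varieties)` ∧
`NonCMDeepMiddleSections[]` (CM-anchored flat-section data over the Hodge locus; print: moduli + CDK + CM point)
∧ `AbelianFibres[]` (GIT 6.14) ∧ `LocalVHCAtCMDeepMiddle[]` (the local variational Hodge germ at a CM fibre, deep
middle). This file removes `AbelianFibres[]`: the section data of child 2 ALREADY says that the flat transport of `c`
is rational `(p,p)` on EVERY fibre `𝒳_u` (not only on the fibres presented as abelian varieties), and with that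
stronger reading of "Hodge along the family" (`HodgeAlongAll`) the corners of the germ (extreme codimensions,
Lefschetz `(1,1)`, hard Lefschetz — all THEOREMS of the tree for an arbitrary smooth projective fibre) hold at every
fibre, so the deep-middle localisation no longer needs abelian presentations. PROVED here (no `sorry`, no new
definition; local notations only):

* `conclusionAll_of_not_deepMiddle` — for a smooth projective family of relative dimension `m` and a global class
  `G` rational `(p,p)` on every fibre, `G|_{𝒳_t}` is algebraic at every `t` when `p ≤ 1` or `m ≤ p + 1` (the
  extreme codimensions are the landed `Stubs.conclusion_of_extreme`, `…CMPivotStubLocalVHCAtCM`).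
* `localVHCAtCMAll_of_deepMiddleAll` — **`LocalVHCAtCMDeepMiddleAll[] → LocalVHCAtCMAll[]`** (the germ with
  `HodgeAlongAll` hypothesis is its deep-middle part `4 ≤ m`, `2 ≤ p`, `p + 2 ≤ m`).
* `exists_globalClass_of_section` — **packaging from section data** (Deligne 1968 on the quasi-projective total
  space, the tree's THEOREM `deligne1968_invariantClass_fromTotalSpace_holds`, + the identity principle
  `Stubs.fiberClass_section_eq_of_eq`): a continuous section `σ` of the espace étalé of `R²ᵖ f_* ℂ` through
  `(t, i⁻¹* c)` with values in the locus of Hodge classes IS the global section of a class `G` with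
  `G|_{𝒳_t} = i⁻¹* c` and `G` rational `(p,p)` on every fibre.
* `hodgeAbelianVarieties_of_hodgeCM_of_nonCMDeepMiddleSections_of_localVHCAtCMDeepMiddleAll` — **the gen-3
  composition** (registered sub-goal): `HodgeCM[] → NonCMDeepMiddleSections[] → LocalVHCAtCMDeepMiddleAll[] →
  HodgeAbelianVarieties` — reduce to `dim A ≥ 4`, `2 ≤ p`, `2p ≤ dim A`
  (`Unconditional.hodgeAbelianVarieties_iff_four_le_dim_holds`); CM `A`: child 1; non-CM `A`: package, HC on the CM
  fibre (child 1), germ, Baire spreading (`Stubs.map_fiberι_mem_algebraicClasses_of_isOpen` with the THEOREM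
  `charlesSchnell_algebraicityLocus_iUnion_closed_holds`), iso-transport back to `A`.
* Upper bound `localVHCAtCMAll_of_hodgeAbelianVarieties` — the new germ is implied by the crux GIVEN abelian fibres
  (so it still claims no more than the summit modulo GIT 6.14; without abelian presentations the crux says nothing
  about an abstract fibre).

With the landed bridge `Theorems.HodgeAbelianVarieties.CMPivot.cmSubalgebra_of_isCM` (p138290) child 1 `HodgeCM[]`
is implied by the existing item `CMAbelianHodge` (stmt-3052); the gen-3 skeleton `Lines/cm_pivot.lean` composes the
two. HONEST STATUS: `LocalVHCAtCMDeepMiddleAll[]` is OPEN (= the crux off the CM locus, in family form);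
`NonCMDeepMiddleSections[]` is a print theorem blocked on a DEFINITION (moduli of polarised abelian varieties with
level structure and its universal family; CDK 1995; CM points).
-/

set_option linter.dupNamespace false

noncomputable section

open CategoryTheory
open Literature.AlgebraicGeometry Literature.AlgebraicGeometry.Motives

namespace Summit.HodgeConjecture.HodgeConjecture.Cruxes.HodgeAbelianVarieties.CMPivot.AllFibres

/-! ### Statements (local notations; the gen-1/2 ones verbatim, the `All` variants new) -/

/-- `IsCM[A]` — CM type: an endomorphism with `2 · dim A` distinct eigenvalues on `H¹(A(ℂ); ℂ)`
(verbatim the gallery line's notation). Local notation only. -/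
local notation3 (prettyPrint := false) "IsCM[" A "]" =>
  ∃ (ψ : A ⟶ A) (μ : Fin (2 * AbelianVariety.dim A) → ℂ), Function.Injective μ ∧
    ∀ i, Module.End.HasEigenvalue (HodgeTheory.complexBetti.map ψ.hom.hom.hom 1).hom (μ i)

/-- `QProj[X]` — `X` is quasi-projective over `ℂ`: INLINED body of
`HodgeTheory.IsQuasiProjectiveOver X` (the route file does not import its home module). Local notation only. -/
local notation3 (prettyPrint := false) "QProj[" X "]" =>
  ∃ (P : SchemeOver ℂ) (j : X ⟶ P), IsProjectiveOver P ∧ AlgebraicGeometry.IsOpenImmersion j.left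

/-- `FibreIncl[f, B, e, s]` — `e` presents `B` as THE fibre of `f` over `s` (`≫` spelled out). Local notation only. -/
local notation3 (prettyPrint := false) "FibreIncl[" f ", " B ", " e ", " s "]" =>
  ∃ i : AbelianVariety.X B ≅ fiberOver f s, e = CategoryStruct.comp i.hom (fiberι f s)

/-- `HodgeAlong[S, 𝒳, f, G, p]` — `G` is rational `(p,p)` on every fibre presented as an abelian variety. Local notation only. -/
local notation3 (prettyPrint := false) "HodgeAlong[" S ", " 𝒳 ", " f ", " G ", " p "]" =>
  ∀ (B : AbelianVariety ℂ) (eB : AbelianVariety.X B ⟶ 𝒳) (u : ComplexPoints S),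
    FibreIncl[f, B, eB, u] →
      HodgeTheory.IsRationalClass (HodgeTheory.complexBetti.map eB (2 * p) G) ∧
      HodgeTheory.IsOfHodgeType B.dim B.X (2 * p) p p (HodgeTheory.complexBetti.map eB (2 * p) G)

/-- CHILD 1 `HodgeCM[]` — the Hodge conjecture for complex abelian varieties of CM type. Local notation only. -/
local notation3 (prettyPrint := false) "HodgeCM[]" =>
  ∀ A : AbelianVariety ℂ, IsCM[A] → HodgeTheory.HodgeConjectureFor A.dim A.X

/-- CHILD 2 `CMAnchoredFamilies[]` — CM-anchored Mumford–Tate packaging of every rational `(p,p)` class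
(the gallery line's `CMFamilies[]` clause (b), gen 3, with the total space quasi-projective; clause (a)
"Hodge models exist" dropped, being the theorem `Stubs.cmFamilies_nonempty_hodgeModel`). Local notation only. -/
local notation3 (prettyPrint := false) "CMAnchoredFamilies[]" =>
  ∀ (A : AbelianVariety ℂ) (p : ℕ) (c : HodgeTheory.complexBetti A.X (2 * p)),
    HodgeTheory.IsRationalClass c → HodgeTheory.IsOfHodgeType A.dim A.X (2 * p) p p c →
    ∃ (S 𝒳 : SchemeOver ℂ) (f : 𝒳 ⟶ S) (G : HodgeTheory.complexBetti 𝒳 (2 * p))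
      (t s₀ : ComplexPoints S) (e : A.X ⟶ 𝒳) (A₀ : AbelianVariety ℂ) (e₀ : A₀.X ⟶ 𝒳),
      QProj[𝒳] ∧ QProj[S] ∧ AlgebraicGeometry.Smooth S.hom ∧ IrreducibleSpace S.left ∧
      IsSmoothProjectiveFamily f A.dim ∧
      FibreIncl[f, A, e, t] ∧ FibreIncl[f, A₀, e₀, s₀] ∧ IsCM[A₀] ∧
      HodgeTheory.complexBetti.map e (2 * p) G = c ∧ HodgeAlong[S, 𝒳, f, G, p]

/-- CHILD 3 `LocalVHCAtCM[]` — local variational Hodge at a CM fibre (= the gallery line's germ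
`OpenNearCM[]`, worker file p92924, with `IsQuasiProjectiveOver` inlined). Local notation only. -/
local notation3 (prettyPrint := false) "LocalVHCAtCM[]" =>
  ∀ (S 𝒳 : SchemeOver ℂ) (f : 𝒳 ⟶ S) (m p : ℕ) (G : HodgeTheory.complexBetti 𝒳 (2 * p))
    (s₀ : ComplexPoints S) (A₀ : AbelianVariety ℂ) (e₀ : A₀.X ⟶ 𝒳),
    QProj[𝒳] → QProj[S] → AlgebraicGeometry.Smooth S.hom → IrreducibleSpace S.left →
    IsSmoothProjectiveFamily f m →
    FibreIncl[f, A₀, e₀, s₀] → IsCM[A₀] →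
    HodgeTheory.complexBetti.map e₀ (2 * p) G ∈ HodgeTheory.algebraicClasses A₀.X p →
    HodgeAlong[S, 𝒳, f, G, p] →
    ∃ U : Set (ComplexPoints S), IsOpen U ∧ s₀ ∈ U ∧ ∀ t ∈ U,
      HodgeTheory.complexBetti.map (fiberι f t) (2 * p) G ∈
        HodgeTheory.algebraicClasses (fiberOver f t) p

/-- `HodgeAlongAll[S, f, G, m, p]` — the global class `G ∈ H^{2p}(𝒳(ℂ); ℂ)` restricts to a RATIONAL class of
Hodge type `(p,p)` (for dimension `m`) on EVERY fibre `𝒳_u` (not only on abelian-presented ones). Local notation only. -/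
local notation3 (prettyPrint := false) "HodgeAlongAll[" S ", " f ", " G ", " m ", " p "]" =>
  ∀ u : ComplexPoints S,
    HodgeTheory.IsRationalClass (HodgeTheory.complexBetti.map (fiberι f u) (2 * p) G) ∧
    HodgeTheory.IsOfHodgeType m (fiberOver f u) (2 * p) p p (HodgeTheory.complexBetti.map (fiberι f u) (2 * p) G)

/-- `LocalVHCAtCMAll[]` — local variational Hodge at a CM fibre, with Hodge-ness of `G` along ALL fibres as the
hypothesis (otherwise the text of `LocalVHCAtCM[]`). Local notation only. -/
local notation3 (prettyPrint := false) "LocalVHCAtCMAll[]" =>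
  ∀ (S 𝒳 : SchemeOver ℂ) (f : 𝒳 ⟶ S) (m p : ℕ) (G : HodgeTheory.complexBetti 𝒳 (2 * p))
    (s₀ : ComplexPoints S) (A₀ : AbelianVariety ℂ) (e₀ : A₀.X ⟶ 𝒳),
    QProj[𝒳] → QProj[S] → AlgebraicGeometry.Smooth S.hom → IrreducibleSpace S.left →
    IsSmoothProjectiveFamily f m →
    FibreIncl[f, A₀, e₀, s₀] → IsCM[A₀] →
    HodgeTheory.complexBetti.map e₀ (2 * p) G ∈ HodgeTheory.algebraicClasses A₀.X p →
    HodgeAlongAll[S, f, G, m, p] →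
    ∃ U : Set (ComplexPoints S), IsOpen U ∧ s₀ ∈ U ∧ ∀ t ∈ U,
      HodgeTheory.complexBetti.map (fiberι f t) (2 * p) G ∈
        HodgeTheory.algebraicClasses (fiberOver f t) p

/-- `LocalVHCAtCMDeepMiddleAll[]` — the DEEP-MIDDLE part of `LocalVHCAtCMAll[]`: three guards `4 ≤ m → 2 ≤ p →
p + 2 ≤ m →` after the binders, everything else byte-identical. Local notation only. -/
local notation3 (prettyPrint := false) "LocalVHCAtCMDeepMiddleAll[]" =>
  ∀ (S 𝒳 : SchemeOver ℂ) (f : 𝒳 ⟶ S) (m p : ℕ) (G : HodgeTheory.complexBetti 𝒳 (2 * p))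
    (s₀ : ComplexPoints S) (A₀ : AbelianVariety ℂ) (e₀ : A₀.X ⟶ 𝒳),
    4 ≤ m → 2 ≤ p → p + 2 ≤ m →
    QProj[𝒳] → QProj[S] → AlgebraicGeometry.Smooth S.hom → IrreducibleSpace S.left →
    IsSmoothProjectiveFamily f m →
    FibreIncl[f, A₀, e₀, s₀] → IsCM[A₀] →
    HodgeTheory.complexBetti.map e₀ (2 * p) G ∈ HodgeTheory.algebraicClasses A₀.X p →
    HodgeAlongAll[S, f, G, m, p] →
    ∃ U : Set (ComplexPoints S), IsOpen U ∧ s₀ ∈ U ∧ ∀ t ∈ U,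
      HodgeTheory.complexBetti.map (fiberι f t) (2 * p) G ∈
        HodgeTheory.algebraicClasses (fiberOver f t) p

/-- `NonCMDeepMiddleSections[]` — CM-anchored SECTION data over the Hodge locus for a NON-CM abelian variety of
dimension `≥ 4` and a rational `(p,p)` class in the deep middle `2 ≤ p`, `2p ≤ dim A` (the landed helper file's
`NonCMSections[]`, `Theorems/PadicSemiregularLiftHodgeAbelianVarietiesCMPivotStubCmAnchoredFamilies.lean`, p137954,
with the three guards `4 ≤ A.dim →`, `2 ≤ p →`, `2 * p ≤ A.dim →` inserted; outside the deep middle HC is a theorem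
of the tree, `Unconditional.hodgeAbelianVarieties_iff_four_le_dim_holds`, so no packaging is needed there). In print:
the universal family over the fine moduli scheme `A_{g,d,n}`, the Hodge-locus component through `(A, c)`
(Cattani–Deligne–Kaplan 1995), a CM point on it (Mumford 1969 / Deligne 1982), the tautological flat section.
Local notation only. [cite: CattaniDeligneKaplan1995JAMS, Thm. 1.1 and Cor. 1.2] [cite: GreenGriffithsKerr2012, Lemma (VI.C.1)] -/
local notation3 (prettyPrint := false) "NonCMDeepMiddleSections[]" =>
  ∀ (A : AbelianVariety ℂ), ¬ IsCM[A] → 4 ≤ A.dim → ∀ (p : ℕ) (c : HodgeTheory.complexBetti A.X (2 * p)),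
    2 ≤ p → 2 * p ≤ A.dim →
    HodgeTheory.IsRationalClass c → HodgeTheory.IsOfHodgeType A.dim A.X (2 * p) p p c →
    ∃ (S 𝒳 : SchemeOver ℂ) (f : 𝒳 ⟶ S) (t s₀ : ComplexPoints S) (i : A.X ≅ fiberOver f t)
      (A₀ : AbelianVariety ℂ) (e₀ : A₀.X ⟶ 𝒳) (σ : ComplexPoints S → HodgeTheory.FiberClass f (2 * p)),
      QProj[𝒳] ∧ QProj[S] ∧ AlgebraicGeometry.Smooth S.hom ∧ IrreducibleSpace S.left ∧
      IsSmoothProjectiveFamily f A.dim ∧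
      FibreIncl[f, A₀, e₀, s₀] ∧ IsCM[A₀] ∧
      Continuous σ ∧ (∀ s, (σ s).pt = s) ∧
      (∀ s, σ s ∈ HodgeTheory.locusOfHodgeClasses f A.dim p) ∧
      σ t = ⟨t, HodgeTheory.complexBetti.map i.inv (2 * p) c⟩

/-- `AbelianFibres[]` — every complex fibre of such a family is presented by an abelian variety (GIT Thm. 6.14;
HYPOTHESIS of the upper bound only, never asserted; verbatim from `…CMPivotStubLocalVHCAtCM`). Local notation only.
[cite: MumfordFogartyKirwan1994, Ch. 6 §1 Thm. 6.14] -/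
local notation3 (prettyPrint := false) "AbelianFibres[]" =>
  ∀ (S 𝒳 : SchemeOver ℂ) (f : 𝒳 ⟶ S) (m : ℕ) (s₀ : ComplexPoints S) (A₀ : AbelianVariety ℂ)
    (e₀ : A₀.X ⟶ 𝒳), QProj[𝒳] → QProj[S] → AlgebraicGeometry.Smooth S.hom → IrreducibleSpace S.left →
    IsSmoothProjectiveFamily f m → FibreIncl[f, A₀, e₀, s₀] →
    ∀ t : ComplexPoints S, ∃ (B : AbelianVariety ℂ) (eB : B.X ⟶ 𝒳), FibreIncl[f, B, eB, t]

/-! ### Corners at an arbitrary fibre (no abelian presentation) -/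

section Corners

variable {S 𝒳 : SchemeOver ℂ} {f : 𝒳 ⟶ S} {m : ℕ}

/-- **All corners at an arbitrary fibre**: outside the deep middle — `p ≤ 1` or `m ≤ p + 1` — `G|_{𝒳_t}` is
algebraic as soon as it is rational `(p,p)` on the smooth projective `m`-fold `𝒳_t` (extreme codimensions;
`p = 1`: Lefschetz `(1,1)`, `lefschetzOneOne_rational_holds`; `p + 1 = m ≥ 3`: hard Lefschetz `L^{m-2}`,
`HardLefschetzNFold.mem_algebraicClasses_of_lt_holds`, back to Lefschetz `(1,1)`).
[cite: VoisinHodgeI2002, Thm. 6.25, Rem. 6.27 and Thm. 11.30] [cite: KerrPearlstein2011, §3.1] -/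
theorem conclusionAll_of_not_deepMiddle (hf : IsSmoothProjectiveFamily f m) {p : ℕ} (hp : p ≤ 1 ∨ m ≤ p + 1)
    {G : HodgeTheory.complexBetti 𝒳 (2 * p)} {t : ComplexPoints S}
    (hrat : HodgeTheory.IsRationalClass (HodgeTheory.complexBetti.map (fiberι f t) (2 * p) G))
    (hpp : HodgeTheory.IsOfHodgeType m (fiberOver f t) (2 * p) p p
      (HodgeTheory.complexBetti.map (fiberι f t) (2 * p) G)) :
    HodgeTheory.complexBetti.map (fiberι f t) (2 * p) G ∈
      HodgeTheory.algebraicClasses (fiberOver f t) p := by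
  by_cases hext : p = 0 ∨ m ≤ p
  · exact Stubs.conclusion_of_extreme hf hext G t
  have hX : IsSmoothProjective m (fiberOver f t) := hf.isSmoothProjective t
  -- Lefschetz `(1,1)` on `𝒳_t`, in every spelling `q = 1` of the codimension
  have h11 : ∀ q : ℕ, q = 1 → ∀ c' : HodgeTheory.complexBetti (fiberOver f t) (2 * q),
      HodgeTheory.IsRationalClass c' → HodgeTheory.IsOfHodgeType m (fiberOver f t) (2 * q) q q c' →
        c' ∈ HodgeTheory.algebraicClasses (fiberOver f t) q := by
    rintro q rfl c' hc' hpp'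
    exact HodgeTheory.lefschetzOneOne_rational_holds hX c' hc' hpp'
  by_cases h1 : p = 1
  · subst h1
    exact h11 1 rfl _ hrat hpp
  · -- `p + 1 = m ≥ 3`: hard Lefschetz from codimension `m - p = 1`
    exact HodgeTheory.HardLefschetzNFold.mem_algebraicClasses_of_lt_holds hX (by omega)
      (h11 (m - p) (by omega)) _ hrat hpp

end Corners

/-! ### The deep-middle localisation without abelian presentations -/

/-- **`LocalVHCAtCMDeepMiddleAll[] → LocalVHCAtCMAll[]`**: outside the deep middle the instance holds with
`U = S(ℂ)` (`conclusionAll_of_not_deepMiddle` at every fibre, fed by `HodgeAlongAll`); inside it `4 ≤ m` is forced.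
[cite: VoisinHodgeI2002, Thm. 6.25 and Thm. 11.30] -/
theorem localVHCAtCMAll_of_deepMiddleAll : LocalVHCAtCMDeepMiddleAll[] → LocalVHCAtCMAll[] := by
  intro h S 𝒳 f m p G s₀ A₀ e₀ h𝒳 hS hsm hirr hf hA₀ hCM halg hH
  by_cases hdm : 2 ≤ p ∧ p + 2 ≤ m
  · exact h S 𝒳 f m p G s₀ A₀ e₀ (by omega) hdm.1 hdm.2 h𝒳 hS hsm hirr hf hA₀ hCM halg hH
  · refine ⟨Set.univ, isOpen_univ, Set.mem_univ _, fun t _ => ?_⟩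
    exact conclusionAll_of_not_deepMiddle hf (by omega) (hH t).1 (hH t).2

/-! ### Packaging from section data (Deligne 1968 + the identity principle) -/

/-- **A global class from a flat section through `(t, i⁻¹* c)` valued in the locus of Hodge classes**: for a
smooth projective family `f : 𝒳 ⟶ S` of relative dimension `m` with `𝒳`, `S` quasi-projective, `S` smooth
irreducible, and a continuous section `σ` of the espace étalé of `R²ᵖ f_* ℂ` with `σ(s) ∈` locus of Hodge classes
for all `s` and `σ(t) = (t, i⁻¹* c)`: there is `G ∈ H²ᵖ(𝒳(ℂ); ℂ)` with `G|_{𝒳_t} = i⁻¹* c` and `G` rational `(p,p)`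
on EVERY fibre. Deligne 1968 (degeneration of Leray, the tree's THEOREM `deligne1968_invariantClass_fromTotalSpace_holds`)
produces `G` with `σ(t) = (t, G|_{𝒳_t})`; the global section of `G` is continuous and agrees with `σ` at `t`, hence
everywhere (`Stubs.fiberClass_section_eq_of_eq`: Ehresmann + flatness). [cite: VoisinHodgeII2003, Theorem 4.18 (with Lemma 4.17)]
[cite: Deligne1968, Proposition (2.1) with (2.6.3)] -/
theorem exists_globalClass_of_section {S 𝒳 : SchemeOver ℂ} (f : 𝒳 ⟶ S) {m p : ℕ} {X : SchemeOver ℂ}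
    (t : ComplexPoints S) (i : X ≅ fiberOver f t) (c : HodgeTheory.complexBetti X (2 * p))
    (σ : ComplexPoints S → HodgeTheory.FiberClass f (2 * p))
    (h𝒳 : HodgeTheory.IsQuasiProjectiveOver 𝒳) (hSqp : HodgeTheory.IsQuasiProjectiveOver S)
    (hS : AlgebraicGeometry.Smooth S.hom) (hSirr : IrreducibleSpace S.left)
    (hf : IsSmoothProjectiveFamily f m)
    (hσ : Continuous σ) (hpt : ∀ s, (σ s).pt = s)
    (hloc : ∀ s, σ s ∈ HodgeTheory.locusOfHodgeClasses f m p)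
    (hσt : σ t = ⟨t, HodgeTheory.complexBetti.map i.inv (2 * p) c⟩) :
    ∃ G : HodgeTheory.complexBetti 𝒳 (2 * p),
      HodgeTheory.complexBetti.map (fiberι f t) (2 * p) G = HodgeTheory.complexBetti.map i.inv (2 * p) c ∧
      HodgeAlongAll[S, f, G, m, p] := by
  obtain ⟨G, hG⟩ := HodgeTheory.deligne1968_invariantClass_fromTotalSpace_holds 𝒳 S f m hf h𝒳
    hSqp hS (2 * p) σ hσ hpt t
  have hsec : ∀ s, σ s = HodgeTheory.globalSection f (2 * p) G s :=
    SubtorusGalleryBlochSeeds.Stubs.fiberClass_section_eq_of_eq f hf hS hSqp hSirr (2 * p) hσ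
      (HodgeTheory.continuous_globalSection f _ G) hpt (fun _ ↦ rfl) hG
  refine ⟨G, (HodgeTheory.FiberClass.mk_eq_mk_iff _ _).1 ((hsec t).symm.trans hσt), fun u => ?_⟩
  obtain ⟨hrat, hhodge⟩ := (HodgeTheory.mem_locusOfHodgeClasses_iff _).1 ((hsec u) ▸ hloc u)
  exact ⟨hrat, hhodge⟩

/-! ### The gen-3 composition (registered sub-goal) -/

/-- **HC for abelian varieties from the three gen-3 statements** — `HodgeCM[]` (child 1; implied by the existing
item stmt-3052 via the landed bridge `Theorems.HodgeAbelianVarieties.CMPivot.cmSubalgebra_of_isCM`),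
`NonCMDeepMiddleSections[]` (section data, print), `LocalVHCAtCMDeepMiddleAll[]` (the open germ). Proof: reduce to
`dim A ≥ 4`, `2 ≤ p`, `2p ≤ dim A` (`Unconditional.hodgeAbelianVarieties_iff_four_le_dim_holds`: Lefschetz `(1,1)`, hard
Lefschetz and `dim ≤ 3` are theorems); a CM `A` is child 1; for a non-CM `A` take the section data, package it
(`exists_globalClass_of_section`), get algebraicity of `G` on the CM fibre `A₀` from child 1 (rationality and type of
`e₀^* G` transported from the fibre `𝒳_{s₀}`), an open set of algebraic fibres from the germ
(`localVHCAtCMAll_of_deepMiddleAll`), all fibres by Baire spreading (`Stubs.map_fiberι_mem_algebraicClasses_of_isOpen`,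
THEOREM `charlesSchnell_algebraicityLocus_iUnion_closed_holds`), and `c` by iso-transport along `i : A ≅ 𝒳_t`.
[folklore assembly] [cite: BlochEsnaultKerz2014CharZero, appendix] [cite: CharlesSchnell2014Notes, Prop. 11.3.5 and proof of Prop. 11.3.11] -/
theorem hodgeAbelianVarieties_of_hodgeCM_of_nonCMDeepMiddleSections_of_localVHCAtCMDeepMiddleAll :
    HodgeCM[] → NonCMDeepMiddleSections[] → LocalVHCAtCMDeepMiddleAll[] →
      Summit.HodgeConjecture.HodgeConjecture.Theses.PadicSemiregularLift.HodgeAbelianVarieties := by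
  intro hcm hsec hgerm
  have hopen : LocalVHCAtCMAll[] := localVHCAtCMAll_of_deepMiddleAll hgerm
  refine Summit.HodgeConjecture.HodgeConjecture.Theorems.HodgeAbelianVarieties.Unconditional.hodgeAbelianVarieties_iff_four_le_dim_holds.2
    fun A h4 p hp2 hpp c hc hH => ?_
  by_cases hA : IsCM[A]
  · exact (hcm A hA).2 p c hc hH
  obtain ⟨S, 𝒳, f, t, s₀, i, A₀, e₀, σ, h𝒳, hSqp, hS, hSirr, hf, hA₀, hCM, hσ, hpt, hloc, hσt⟩ :=
    hsec A hA h4 p c hp2 hpp hc hH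
  obtain ⟨G, hGt, hHall⟩ :=
    exists_globalClass_of_section f t i c σ h𝒳 hSqp hS hSirr hf hσ hpt hloc hσt
  -- child 1 on the CM fibre `A₀ ≅ 𝒳_{s₀}`
  have halg₀ : HodgeTheory.complexBetti.map e₀ (2 * p) G ∈ HodgeTheory.algebraicClasses A₀.X p := by
    have hdim : A₀.dim = A.dim := SubtorusGalleryBlochSeeds.Stubs.dim_eq_of_fibreIncl hf hA₀
    obtain ⟨i₀, rfl⟩ := hA₀
    obtain ⟨hrat₀, hhodge₀⟩ := hHall s₀
    refine (hcm A₀ hCM).2 p _ ?_ ?_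
    · rw [HodgeTheory.complexBetti.map_comp, CategoryTheory.comp_apply]
      exact hrat₀.pullback _
    · rw [HodgeTheory.complexBetti.map_comp, CategoryTheory.comp_apply, hdim]
      exact hhodge₀.map_of_iso i₀
  -- the germ, then Baire spreading, at the fibre `𝒳_t`
  obtain ⟨U, hU, hs₀U, hUalg⟩ :=
    hopen S 𝒳 f A.dim p G s₀ A₀ e₀ h𝒳 hSqp hS hSirr hf hA₀ hCM halg₀ hHall
  have hGtalg : HodgeTheory.complexBetti.map (fiberι f t) (2 * p) G ∈
      HodgeTheory.algebraicClasses (fiberOver f t) p :=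
    SubtorusGalleryBlochSeeds.Stubs.map_fiberι_mem_algebraicClasses_of_isOpen
      HodgeTheory.charlesSchnell_algebraicityLocus_iUnion_closed_holds f h𝒳 hSqp hS hSirr hf G hU ⟨s₀, hs₀U⟩
      hUalg t
  -- back to `A` along `i`
  have hA' : HodgeTheory.complexBetti.map (i.hom ≫ fiberι f t) (2 * p) G ∈ HodgeTheory.algebraicClasses A.X p :=
    (SubtorusGalleryBlochSeeds.Stubs.map_mem_algebraicClasses_iff_of_fibreIncl hf
      (B := A) (eB := i.hom ≫ fiberι f t) (u := t) ⟨i, rfl⟩ p G).2 hGtalg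
  rw [HodgeTheory.complexBetti.map_comp, CategoryTheory.comp_apply, hGt] at hA'
  rwa [i.complexBetti_map_hom_map_inv (2 * p) c] at hA'

/-! ### Upper bound: the new germ claims no more than the crux, given abelian fibres -/

/-- Given `AbelianFibres[]` (GIT 6.14, HYPOTHESIS), `LocalVHCAtCMAll[]` follows from the crux: at each `t` present
the fibre by an abelian variety `B`, transport rationality and type of `G|_{𝒳_t}` to `B` (iso-invariance, dimension
`dim B = m`), apply the crux to `B`, transport algebraicity back. [cite: MumfordFogartyKirwan1994, Ch. 6 §1 Thm. 6.14] -/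
theorem localVHCAtCMAll_of_hodgeAbelianVarieties
    (h : Summit.HodgeConjecture.HodgeConjecture.Theses.PadicSemiregularLift.HodgeAbelianVarieties)
    (hAV : AbelianFibres[]) : LocalVHCAtCMAll[] := by
  intro S 𝒳 f m p G s₀ A₀ e₀ h𝒳 hS hsm hirr hf hA₀ _ _ hH
  refine ⟨Set.univ, isOpen_univ, Set.mem_univ _, fun t _ => ?_⟩
  obtain ⟨B, eB, hB⟩ := hAV S 𝒳 f m s₀ A₀ e₀ h𝒳 hS hsm hirr hf hA₀ t
  have hdim : B.dim = m := SubtorusGalleryBlochSeeds.Stubs.dim_eq_of_fibreIncl hf hB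
  obtain ⟨iB, rfl⟩ := hB
  obtain ⟨hrat, hhodge⟩ := hH t
  have hBalg : HodgeTheory.complexBetti.map (iB.hom ≫ fiberι f t) (2 * p) G ∈
      HodgeTheory.algebraicClasses B.X p := by
    refine (h B).2 p _ ?_ ?_
    · rw [HodgeTheory.complexBetti.map_comp, CategoryTheory.comp_apply]
      exact hrat.pullback _
    · rw [HodgeTheory.complexBetti.map_comp, CategoryTheory.comp_apply, hdim]
      exact hhodge.map_of_iso iB
  exact (SubtorusGalleryBlochSeeds.Stubs.map_mem_algebraicClasses_iff_of_fibreIncl hf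
    (B := B) (eB := iB.hom ≫ fiberι f t) (u := t) ⟨iB, rfl⟩ p G).1 hBalg

/-- The gen-2 germ (abelian-presented Hodge-ness) implies the gen-3 germ outright: `HodgeAlongAll` gives
`HodgeAlong` on presented fibres by iso-transport. So gen 3 asks LESS of child 3 than gen 2 did. [folklore] -/
theorem localVHCAtCMAll_of_localVHCAtCM (h : LocalVHCAtCM[]) : LocalVHCAtCMAll[] := by
  intro S 𝒳 f m p G s₀ A₀ e₀ h𝒳 hS hsm hirr hf hA₀ hCM halg hH
  refine h S 𝒳 f m p G s₀ A₀ e₀ h𝒳 hS hsm hirr hf hA₀ hCM halg ?_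
  rintro B eB u ⟨iB, rfl⟩
  have hdim : B.dim = m :=
    SubtorusGalleryBlochSeeds.Stubs.dim_eq_of_fibreIncl hf (B := B) (eB := iB.hom ≫ fiberι f u) (u := u) ⟨iB, rfl⟩
  obtain ⟨hrat, hhodge⟩ := hH u
  rw [HodgeTheory.complexBetti.map_comp, CategoryTheory.comp_apply, hdim]
  exact ⟨hrat.pullback _, hhodge.map_of_iso iB⟩

end Summit.HodgeConjecture.HodgeConjecture.Cruxes.HodgeAbelianVarieties.CMPivot.AllFibres

end
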